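import Literature.AlgebraicGeometry.HodgeTheory.AbelianVarietyFixedPointsFiniteness
import Literature.AlgebraicGeometry.HodgeTheory.AbelianVarietyRationalAnalyticCharpoly
import Literature.AlgebraicGeometry.HodgeTheory.AbelianVarietyIntegralCohomologyPullback
import Literature.AlgebraicGeometry.HodgeTheory.AbelianVarietyEllipticCurveHomDegreeQuadraticForm
import Literature.AlgebraicGeometry.HodgeTheory.AbelianVarietyEllipticCurveAutomorphisms
import HarnessLib

/-!
# `#Fix(f(ℂ)) = deg(1_A − f) = |Ker(1_A − f)(ℂ)|` for an endomorphism of a complex abelian variety (Lange Prop. 2.4.3 (b) at `n = 1`): the bridge between the topological fixed-point count and the kernel carrier, with the Lefschetz formula `#Fix(ψ) = 1 − t(ψ) + deg ψ` for elliptic curves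

Layer `Literature/AlgebraicGeometry/HodgeTheory`, namespace `Literature.AlgebraicGeometry.HodgeTheory` (theorems in the `AbelianVariety` namespace).
THEOREMS ONLY (no definition, no named fact, no instance, no notation; D-0026 net debt 0).  Two carriers for «the number of fixed points of an
endomorphism `f` of a complex abelian variety `A`» coexist in the tree: the TOPOLOGICAL one, `Nat.card (fixedPoints (f(ℂ)))` for the continuous self-map
`f(ℂ) = AlgPoints.mapContinuous f` of `A(ℂ)` (`AbelianVarietyFixedPointsFiniteness`, `…GrowthMahlerMeasure`, `…DivisibilityPeriodicity`: `#Fix(f(ℂ)) =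
det(1 − f^* | H¹(A(ℂ); ℚ))`), and the GROUP-SCHEME one, `Nat.card (Hom.kerPoints (specOver ℂ ℂ) (𝟙 A − f))`, the complex points of the kernel of `1_A − f`
(`AbelianVarietyEllipticCurveDegreeQuadraticForm`, `…AutomorphismFixedPoints`: `|Ker φ(ℂ)| = det(φ^* | H¹(A(ℂ); ℤ))`).  This file proves they agree — Lange's
Prop. 2.4.3 (b) «`P^r_f(n) = deg(n_X − f)`» at `n = 1` read as `#Fix(f) = deg(1_X − f)` — so that results stated on either carrier transfer.

THE PRINTS.  H. Lange, *Abelian Varieties over the Complex Numbers* [Lange2023AbelianVarietiesComplex] §2.4.1 Prop. 2.4.3 (b) (PDF p. 114): «`P^r_f(n) =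
deg(n_X − f)` for all `n ∈ ℤ`»; §1.1.3 (PDF p. 23) (rational and integral representations, `H¹(X, F) = H¹(X, ℤ) ⊗ F`).  M. Alvarado, R. Auffarth
[AlvaradoAuffarth2018] §1 eq. (1) (arXiv p. 3): «the Lefschetz Fixed-Point Theorem for complex tori gives the exact number of fixed points … `#Fix(fⁿ) =
|∏ (1 − λᵢⁿ)|²`».  I. Farmakis, M. Moskowitz [FarmakisMoskowitz2013] §5.5.2 (Lefschetz number of a torus map).  For curves: `#Fix(ψ) = 1 − tr(ψ^* | H¹) +
deg ψ` (the Lefschetz trace formula `Σ (−1)^i Tr(ψ^* | Hⁱ)`, `H⁰, H²` contributing `1` and `deg ψ`).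

THE PROOF.  `(#Fix(f(ℂ)) : ℚ) = det(1 − f^*_ℚ)` (tree, topological side); `(|Ker(1 − f)(ℂ)| : ℤ) = det((1 − f)^*_ℤ)` (tree, kernel side); `det` commutes
with `ℤ → ℚ` in the compatible bases of `H¹(–; ℤ)` and `H¹(–; ℚ)` (tree, `cast_det_singularCohomology_map_int`); and `(1 − f)^*_ℚ = 1 − f^*_ℚ`, which is
proved here from the integral additivity `(f − g)^*_ℤ = f^*_ℤ − g^*_ℤ` (`singularCohomology_int_map_sub_one`) read in those bases
(`exists_basis_toMatrix_singularCohomology_map_eq_map_int`).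

## What is proved (`A : Motives.AbelianVariety ℂ`, `f g u : A ⟶ A`; `E` with `dim E = 1`, `ψ : E ⟶ E`, `v : (End E)ˣ`)

* §1 (any dimension) `hom_singularCohomology_rat_map_sub_one` (`(f − g)^* = f^* − g^*` on `H¹(A(ℂ); ℚ)`), `hom_singularCohomology_rat_map_id_one`,
  `hom_singularCohomology_rat_map_id_sub_one` (`(𝟙 − u)^* = 1 − u^*`), `cast_natCard_kerPoints_id_sub_eq_det_one_sub_rat`
  (`|Ker(1 − u)(ℂ)| = det(1 − u^* | H¹(A(ℂ); ℚ))`), **`natCard_fixedPoints_eq_natCard_kerPoints_id_sub`** (`#Fix(u(ℂ)) = |Ker(1_A − u)(ℂ)|`),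
  `finite_and_nonempty_fixedPoints_iff_isIsogeny_id_sub` (`Fix(u(ℂ))` is finite and non-empty iff `1_A − u` is an isogeny).
* §2 (complex elliptic curves) **`cast_natCard_fixedPoints_eq_of_dim_eq_one`** (`#Fix(ψ(ℂ)) = 1 − t(ψ) + deg ψ` in `ℤ`, the Lefschetz formula for an
  endomorphism of an elliptic curve), `natCard_fixedPoints_pos_iff_of_dim_eq_one` (`#Fix(ψ(ℂ)) ≥ 1 ↔ ψ ≠ 𝟙`: every endomorphism other than the identity has
  a fixed point and finitely many), `natCard_fixedPoints_eq_zero_iff_of_dim_eq_one`, **`cast_natCard_fixedPoints_units_of_dim_eq_one`** (`#Fix(v(ℂ)) =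
  2 − t(v)` for an automorphism, the topological form of `AbelianVarietyEllipticCurveAutomorphismFixedPoints`), `natCard_fixedPoints_units_le_four_of_dim_eq_one`.

## SCOPE

Endomorphisms (homomorphisms `A → A` fixing the origin) only: for a general self-map `x ↦ u(x) + a` the topological count is the tree's
`AbelianVarietyFixedPointsFiniteness`, and no kernel reading is claimed.  Nothing here is a case of the Hodge conjecture.

## References

* [Lange2023AbelianVarietiesComplex] H. Lange, *Abelian Varieties over the Complex Numbers*, Grundlehren Text Editions, Springer 2023 — §1.1.3 (PDF p. 23);
  §2.4.1 Prop. 2.4.3 (b) (PDF p. 114).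
* [AlvaradoAuffarth2018] M. Alvarado, R. Auffarth, *Fixed points of endomorphisms of complex tori*, J. Algebra 507 (2018) 428–441 — §1 eq. (1).
* [FarmakisMoskowitz2013] I. Farmakis, M. Moskowitz, *Fixed Point Theorems and Their Applications*, World Scientific 2013 — §5.5.2.
* [SilvermanAEC2009] J. H. Silverman, *The Arithmetic of Elliptic Curves*, 2nd ed., GTM 106, Springer 2009 — III §10 Thm. 10.1; V §2 (proof of Thm. 2.3.1:
  `#E(𝔽_q) = deg(1 − φ)`).

## Provenance

lit-hodgefound prover seat p21, generation 47, row g47-#10 (own row, claimed by path; bridge between the seat's kernel carrier (g46-#1, g46-#15, g47-#6) and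
the topological fixed-point files of the lane).
-/

open Function CategoryTheory Module
open Literature.AlgebraicTopology.SingularHomology

namespace Literature.AlgebraicGeometry.HodgeTheory

namespace AbelianVariety

open _root_.AlgebraicGeometry
open Literature.AlgebraicGeometry.Motives
open Literature.AlgebraicGeometry.Motives.AbelianVariety

variable {A : Motives.AbelianVariety ℂ}

/-! ### §1 `(1 − u)^* = 1 − u^*` over `ℚ`, and `#Fix(u(ℂ)) = |Ker(1 − u)(ℂ)|` -/

/-- **`(f − g)^* = f^* − g^*` on `H¹(A(ℂ); ℚ)`** for endomorphisms `f, g` of a complex abelian variety: the integral additivity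
`(f − g)^*_ℤ = f^*_ℤ − g^*_ℤ` read in compatible bases of `H¹(A(ℂ); ℤ)` and `H¹(A(ℂ); ℚ) = H¹(A(ℂ); ℤ) ⊗ ℚ`.
[cite: Lange2023AbelianVarietiesComplex, §1.1.2 (1.4) and §1.1.3 (PDF pp. 19–23)] -/
theorem hom_singularCohomology_rat_map_sub_one (f g : A ⟶ A) :
    (singularCohomology.map ℚ ℚ (AlgPoints.mapContinuous (L := ℂ) (f - g).hom.hom.hom) 1).hom =
      (singularCohomology.map ℚ ℚ (AlgPoints.mapContinuous (L := ℂ) f.hom.hom.hom) 1).hom -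
        (singularCohomology.map ℚ ℚ (AlgPoints.mapContinuous (L := ℂ) g.hom.hom.hom) 1).hom := by
  classical
  obtain ⟨bZ, bQ, hb⟩ := exists_basis_toMatrix_singularCohomology_map_eq_map_int A ℚ 1
  apply (LinearMap.toMatrix bQ bQ).injective
  rw [map_sub (LinearMap.toMatrix bQ bQ), hb, hb, hb, singularCohomology_int_map_sub_one, ModuleCat.hom_sub,
    map_sub (LinearMap.toMatrix bZ bZ)]
  exact Matrix.map_sub _ (fun a b => map_sub (Int.castRingHom ℚ) a b) _ _

/-- `(𝟙_A)^* = 1` on `H¹(A(ℂ); ℚ)`. [cite: Lange2023AbelianVarietiesComplex, §1.1.2 (1.4) (PDF p. 19)] -/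
theorem hom_singularCohomology_rat_map_id_one (A : Motives.AbelianVariety ℂ) :
    (singularCohomology.map ℚ ℚ (AlgPoints.mapContinuous (L := ℂ) (𝟙 A : A ⟶ A).hom.hom.hom) 1).hom = 1 := by
  change (singularCohomology.map ℚ ℚ (AlgPoints.mapContinuous (L := ℂ) (𝟙 A.X)) 1).hom = _
  rw [AlgPoints.mapContinuous_id, singularCohomology.map_id]
  rfl

/-- **`(1_A − u)^* = 1 − u^*` on `H¹(A(ℂ); ℚ)`.** [cite: Lange2023AbelianVarietiesComplex, §1.1.2 (1.4) and §2.4.1 Prop. 2.4.3 (b) (PDF pp. 19, 114)] -/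
theorem hom_singularCohomology_rat_map_id_sub_one (u : A ⟶ A) :
    (singularCohomology.map ℚ ℚ (AlgPoints.mapContinuous (L := ℂ) (𝟙 A - u).hom.hom.hom) 1).hom =
      1 - (singularCohomology.map ℚ ℚ (AlgPoints.mapContinuous (L := ℂ) u.hom.hom.hom) 1).hom := by
  rw [hom_singularCohomology_rat_map_sub_one, hom_singularCohomology_rat_map_id_one]

/-- **`|Ker(1_A − u)(ℂ)| = det(1 − u^* | H¹(A(ℂ); ℚ))`** («`deg(n_X − f) = P^r_f(n)`» at `n = 1`, the kernel side read rationally).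
[cite: Lange2023AbelianVarietiesComplex, §2.4.1 Prop. 2.4.3 (b) (PDF p. 114)] -/
theorem cast_natCard_kerPoints_id_sub_eq_det_one_sub_rat (u : A ⟶ A) :
    (Nat.card (Hom.kerPoints (specOver ℂ ℂ) (𝟙 A - u)) : ℚ) =
      LinearMap.det (1 - (singularCohomology.map ℚ ℚ (AlgPoints.mapContinuous (L := ℂ) u.hom.hom.hom) 1).hom) := by
  have h2 := natCard_kerPoints_eq_det_singularCohomology_map_one (𝟙 A - u)
  have h3 := cast_det_singularCohomology_map_int A ℚ (AlgPoints.mapContinuous (L := ℂ) (𝟙 A - u).hom.hom.hom) 1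
  rw [hom_singularCohomology_rat_map_id_sub_one] at h3
  rw [← h3, ← h2, Int.cast_natCast]

/-- **THE BRIDGE: `#Fix(u(ℂ)) = |Ker(1_A − u)(ℂ)|`** for every endomorphism `u` of a complex abelian variety `A` — the number of fixed points of the
continuous map `u(ℂ)` of `A(ℂ)` (`Nat.card`, `0` if infinite) equals the number of complex points of the kernel of `1_A − u` (`Nat.card`, `0` if
infinite); both are `det(1 − u^* | H¹(A(ℂ); ℚ)) = deg(1_A − u)` («`P^r_f(1) = deg(1_X − f)`»). [cite: Lange2023AbelianVarietiesComplex, §2.4.1 Prop. 2.4.3 (b)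
(PDF p. 114)] [cite: AlvaradoAuffarth2018, §1 eq. (1)] -/
theorem natCard_fixedPoints_eq_natCard_kerPoints_id_sub (u : A ⟶ A) :
    Nat.card (fixedPoints (AlgPoints.mapContinuous (L := ℂ) u.hom.hom.hom)) = Nat.card (Hom.kerPoints (specOver ℂ ℂ) (𝟙 A - u)) := by
  have h1 := AbelianVariety.natCard_fixedPoints_eq_det_one_sub A u.hom.hom.hom
  rw [← cast_natCard_kerPoints_id_sub_eq_det_one_sub_rat] at h1
  exact_mod_cast h1

/-- **`Fix(u(ℂ))` is finite and non-empty iff `1_A − u` is an isogeny** (both say `det(1 − u^*) ≠ 0`). [cite: Lange2023AbelianVarietiesComplex, §2.4.1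
Prop. 2.4.3 (b) and §1.1.2 Prop. 1.1.13] [cite: FarmakisMoskowitz2013, §5.5.2] -/
theorem finite_and_nonempty_fixedPoints_iff_isIsogeny_id_sub (u : A ⟶ A) :
    ((fixedPoints (AlgPoints.mapContinuous (L := ℂ) u.hom.hom.hom)).Finite ∧
        (fixedPoints (AlgPoints.mapContinuous (L := ℂ) u.hom.hom.hom)).Nonempty) ↔ IsIsogeny (𝟙 A - u) := by
  rw [AbelianVariety.finite_and_nonempty_fixedPoints_iff_det_ne_zero, isIsogeny_iff_det_singularCohomology_map_one_ne_zero,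
    ← Int.cast_ne_zero (α := ℚ), cast_det_singularCohomology_map_int A ℚ _ 1, hom_singularCohomology_rat_map_id_sub_one]

/-! ### §2 Complex elliptic curves: `#Fix(ψ(ℂ)) = 1 − t(ψ) + deg ψ` -/

section DimOne

variable (hA : A.dim = 1)
include hA

/-- **THE LEFSCHETZ FORMULA FOR AN ENDOMORPHISM OF A COMPLEX ELLIPTIC CURVE, topological carrier: `#Fix(ψ(ℂ)) = 1 − tr(ψ^* | H¹(E(ℂ); ℤ)) + deg ψ`**
(`= deg(1 − ψ)`; `H⁰` and `H²` contribute `1` and `deg ψ`). [cite: Lange2023AbelianVarietiesComplex, §2.4.1 Prop. 2.4.3 (b) (PDF p. 114)]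
[cite: SilvermanAEC2009, V §2 (proof of Thm. 2.3.1)] [cite: FarmakisMoskowitz2013, §5.5.2] -/
theorem cast_natCard_fixedPoints_eq_of_dim_eq_one (ψ : A ⟶ A) :
    (Nat.card (fixedPoints (AlgPoints.mapContinuous (L := ℂ) ψ.hom.hom.hom)) : ℤ) =
      1 - LinearMap.trace ℤ _ (singularCohomology.map ℤ ℤ (AlgPoints.mapContinuous (L := ℂ) ψ.hom.hom.hom) 1).hom +
        Nat.card (Hom.kerPoints (specOver ℂ ℂ) ψ) := by
  rw [natCard_fixedPoints_eq_natCard_kerPoints_id_sub, natCard_kerPoints_id_sub_eq_of_dim_eq_one hA,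
    natCard_kerPoints_eq_det_singularCohomology_map_one]

/-- **`#Fix(ψ(ℂ)) ≥ 1 ↔ ψ ≠ 𝟙`**: every endomorphism of a complex elliptic curve other than the identity has a fixed point, and finitely many
(`1 − ψ ≠ 0` is an isogeny); the identity fixes the infinitely many points of `E(ℂ)` (`Nat.card = 0`). [cite: Lange2023AbelianVarietiesComplex, §2.4.1
Prop. 2.4.3 (b)] [cite: AlvaradoAuffarth2018, §1 eq. (1)] -/
theorem natCard_fixedPoints_pos_iff_of_dim_eq_one (ψ : A ⟶ A) :
    0 < Nat.card (fixedPoints (AlgPoints.mapContinuous (L := ℂ) ψ.hom.hom.hom)) ↔ ψ ≠ 𝟙 A := by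
  rw [natCard_fixedPoints_eq_natCard_kerPoints_id_sub, natCard_kerPoints_pos_iff_of_dim_eq_one hA hA, sub_ne_zero, ne_comm]

/-- `#Fix(ψ(ℂ)) = 0 ↔ ψ = 𝟙` (Alvarado–Auffarth's convention «`0` if not finite» singles out the identity). [cite: AlvaradoAuffarth2018, §1 («and `0` if not»)]
[cite: Lange2023AbelianVarietiesComplex, §2.4.1 Prop. 2.4.3 (b)] -/
theorem natCard_fixedPoints_eq_zero_iff_of_dim_eq_one (ψ : A ⟶ A) :
    Nat.card (fixedPoints (AlgPoints.mapContinuous (L := ℂ) ψ.hom.hom.hom)) = 0 ↔ ψ = 𝟙 A := by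
  have h := natCard_fixedPoints_pos_iff_of_dim_eq_one hA ψ
  constructor
  · intro h0
    by_contra hne
    exact absurd (h.2 hne) (by rw [h0]; exact lt_irrefl 0)
  · intro h1
    by_contra h0
    exact h.1 (Nat.pos_of_ne_zero h0) h1

/-- **`#Fix(v(ℂ)) = 2 − t(v)` for an AUTOMORPHISM `v` of a complex elliptic curve**, on the topological carrier (`deg v = 1`; the kernel-carrier form is
the tree's `natCard_kerPoints_one_sub_units`). [cite: AlvaradoAuffarth2018, §1 eq. (1) (`#Fix(f) = |1 − λ|²`)] [cite: SilvermanAEC2009, III §10 Thm. 10.1] -/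
theorem cast_natCard_fixedPoints_units_of_dim_eq_one (v : (End A)ˣ) :
    (Nat.card (fixedPoints (AlgPoints.mapContinuous (L := ℂ) (v : End A).hom.hom.hom)) : ℤ) =
      2 - LinearMap.trace ℤ _ (singularCohomology.map ℤ ℤ (AlgPoints.mapContinuous (L := ℂ) (v : End A).hom.hom.hom) 1).hom := by
  rw [cast_natCard_fixedPoints_eq_of_dim_eq_one hA, natCard_kerPoints_units]
  ring

/-- `#Fix(v(ℂ)) ≤ 4` for an automorphism (`t(v) ≥ −2`). [cite: AlvaradoAuffarth2018, §1 eq. (1)] [cite: SilvermanAEC2009, III §10 Thm. 10.1] -/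
theorem natCard_fixedPoints_units_le_four_of_dim_eq_one (v : (End A)ˣ) :
    Nat.card (fixedPoints (AlgPoints.mapContinuous (L := ℂ) (v : End A).hom.hom.hom)) ≤ 4 := by
  have h := cast_natCard_fixedPoints_units_of_dim_eq_one hA v
  have hsq := trace_units_sq_le_four_of_dim_eq_one hA v
  have ht : -2 ≤ LinearMap.trace ℤ _ (singularCohomology.map ℤ ℤ (AlgPoints.mapContinuous (L := ℂ) (v : End A).hom.hom.hom) 1).hom := by
    nlinarith [hsq]
  omega

end DimOne

end AbelianVariety

end Literature.AlgebraicGeometry.HodgeTheory
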